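import Mathlib
import HarnessLib
import Summits.HubbardSuperconductivity.HubbardSuperconductivity.Theorems.KLProgrammeKLRegimeEngineTowerLipschitz
import Summits.HubbardSuperconductivity.HubbardSuperconductivity.Theorems.KLProgrammeKLRegimeEngineTowerScaling

/-!
# Route `KLProgramme` — crux K3 ENGINE (stmt-HubbardSuperconductivity-20437 `KLRegimeEngineV17F2`), stub (e) rows C1/C2 «(e)-C ⇐ (b)-TWOVOL»:
# the index-set glue between the Grassmann LIPSCHITZ supplier «G1-Lip» and the dimensionless Lipschitz tower (part 11, `towerSLip`)
# (cell gate-hubbard-kl, seat hubbard-kl-k3c5-p2 g8; twin of E1's `…EngineTowerScaling` §1–§2 for the mixed graded sum)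

E1's T2-Lip `towerLipStep_le_of_chernoff` (p559494) takes the suppliers' telescoped step hypothesis with the MIXED graded sum
`towerSLip D τ ν μ n p = Σ_{δ ∈ [1,D]^n, p+n−1 ≤ Σδ} Σ_a τ^{δ_a}ν(δ_a)·Π_{b≠a} τ^{δ_b}μ(δ_b)` (one slot carries the difference profile `ν`, the others the
common majorant `μ`).  The Grassmann supplier «G1-Lip» (`Literature.….GrassmannEffectiveActionGradedLipschitzDB`, via the polarised graded cumulant bound
`Literature.….GrassmannCumulantPolarisedGradedDB.sum_norm_kernel_cumulantOf_sub_le_graded_of_gramBounded`) delivers exactly this sum, but indexed by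
`[0, D]^n` (`degs = range (D+1)`) with the leg constraint in the form `2p + 2(n−1) ≤ Σ_a 2δ_a` and the weights `(e²(κ+ρ))^{2δ}`:

* `sum_mul_prod_erase_eq_zero_of_exists_zero` — with the degree-`0` sizes `ν 0 = μ 0 = 0` (no constant parts) an assignment with a zero entry
  contributes nothing to the mixed sum (the zero sits either in the odd slot or in the product);
* **`sum_range_filter_sum_mul_prod_erase_eq_towerSLip`** — the suppliers' mixed graded sum over `[0,D]^n` IS `towerSLip D τ ν μ n p`;
* `towerSLip_pow_mul` — the scaling dictionary: sizes in units of `c^m` multiply the per-leg-pair weight,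
  `towerSLip D τ (m ↦ c^m ν m) (m ↦ c^m μ m) n p = towerSLip D (τc) ν μ n p` (as `towerS_pow_mul`);
* `pow_two_mul_eq_sq_pow` — `w^{2δ} = (w²)^δ` pointwise form used to read `(e²(κ+ρ))^{2δ_a}` as `τ^{δ_a}`, `τ = (e²(κ+ρ))²` (`= 4e⁴κ²` at `ρ = κ`,
  `exp_two_mul_two_kappa_sq`).

Pure finite-sum algebra; nothing about the model is asserted; nothing asserts superconductivity.
-/

noncomputable section

namespace Summit.HubbardSuperconductivity.HubbardSuperconductivity.Theorems.EngineV8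

set_option linter.dupNamespace false -- summit = problem name (single-conjunct summit), D-0017

open Real Finset

/-! ## §1 Index sets: the suppliers' `[0, D]^n` versus `towerSLip`'s `[1, D]^n` -/

/-- **A mixed product over an assignment with a zero entry vanishes** when the degree-`0` sizes are `0`: the zero entry sits either in the odd
slot (factor `ν 0 = 0`) or in the product over the other slots (factor `μ 0 = 0`). -/
theorem sum_mul_prod_erase_eq_zero_of_exists_zero {n : ℕ} {τ : ℝ} {ν μ : ℕ → ℝ} (hν0 : ν 0 = 0) (hμ0 : μ 0 = 0) {δ : Fin n → ℕ}
    (h : ∃ a, δ a = 0) :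
    ∑ a, τ ^ (δ a) * ν (δ a) * ∏ b ∈ univ.erase a, τ ^ (δ b) * μ (δ b) = 0 := by
  obtain ⟨a₀, ha₀⟩ := h
  refine sum_eq_zero fun a _ => ?_
  by_cases ha : a = a₀
  · subst ha
    rw [ha₀, hν0, mul_zero, zero_mul]
  · rw [prod_eq_zero (mem_erase.2 ⟨Ne.symm ha, mem_univ a₀⟩) (by rw [ha₀, hμ0, mul_zero]), mul_zero]

/-- **The suppliers' mixed graded sum over `[0, D]^n` is `towerSLip`** (degree-`0` sizes `0`): for `1 ≤ n`,
`Σ_{δ ∈ [0,D]^n, 2p + 2(n−1) ≤ Σ 2δ_a} Σ_a τ^{δ_a}ν(δ_a)·Π_{b≠a} τ^{δ_b}μ(δ_b) = towerSLip D τ ν μ n p`. -/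
theorem sum_range_filter_sum_mul_prod_erase_eq_towerSLip {D n : ℕ} (hn : 1 ≤ n) {τ : ℝ} {ν μ : ℕ → ℝ} (hν0 : ν 0 = 0) (hμ0 : μ 0 = 0)
    (p : ℕ) :
    ∑ δ ∈ (Fintype.piFinset fun _ : Fin n => range (D + 1)) with 2 * p + 2 * (n - 1) ≤ ∑ a, 2 * δ a,
        ∑ a, τ ^ (δ a) * ν (δ a) * ∏ b ∈ univ.erase a, τ ^ (δ b) * μ (δ b) = towerSLip D τ ν μ n p := by
  rw [towerSLip]
  symm
  refine sum_subset (fun δ hδ => ?_) (fun δ hδ hδ' => ?_)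
  · rw [mem_filter, Fintype.mem_piFinset] at hδ ⊢
    exact ⟨fun a => mem_range.2 (Nat.lt_succ_of_le (mem_Icc.1 (hδ.1 a)).2), (two_mul_add_le_sum_iff hn p δ).2 hδ.2⟩
  · rw [mem_filter, Fintype.mem_piFinset] at hδ hδ'
    refine sum_mul_prod_erase_eq_zero_of_exists_zero hν0 hμ0 ?_
    by_contra hne
    exact hδ' ⟨fun a => mem_Icc.2 ⟨Nat.pos_of_ne_zero fun h0 => hne ⟨a, h0⟩, Nat.le_of_lt_succ (mem_range.1 (hδ.1 a))⟩,
      (two_mul_add_le_sum_iff hn p δ).1 hδ.2⟩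

/-! ## §2 The scaling dictionary for the mixed sum -/

/-- **Units in the mixed graded sum**: sizes measured in units of `c^m` multiply the per-leg-pair weight,
`towerSLip D τ (m ↦ c^m ν m) (m ↦ c^m μ m) n p = towerSLip D (τ·c) ν μ n p`. -/
theorem towerSLip_pow_mul (D : ℕ) (τ c : ℝ) (ν μ : ℕ → ℝ) (n p : ℕ) :
    towerSLip D τ (fun m => c ^ m * ν m) (fun m => c ^ m * μ m) n p = towerSLip D (τ * c) ν μ n p := by
  unfold towerSLip
  refine sum_congr rfl fun δ _ => sum_congr rfl fun a _ => ?_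
  congr 1
  · rw [mul_pow]; ring
  · exact prod_congr rfl fun b _ => by rw [mul_pow]; ring

/-- `w^{2δ} = (w²)^δ`: the suppliers' per-leg weight `(e²(κ+ρ))^{2δ}` is the per-leg-PAIR weight `τ^δ`, `τ = (e²(κ+ρ))²`. -/
theorem pow_two_mul_eq_sq_pow (w : ℝ) (δ : ℕ) : w ^ (2 * δ) = (w ^ 2) ^ δ := pow_mul w 2 δ

/-- **The suppliers' mixed sum in `towerSLip` form, weights read as per-leg-PAIR weights**: for `1 ≤ n` and degree-`0` sizes `0`,
`Σ_{δ ∈ [0,D]^n, 2p + 2(n−1) ≤ Σ 2δ_a} Σ_a w^{2δ_a}ν(δ_a)·Π_{b≠a} w^{2δ_b}μ(δ_b) = towerSLip D (w²) ν μ n p` — the inner sum of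
`Literature.….sum_norm_kernel_effAction_sub_gaussConv_sub_le_graded_of_gramBounded` at `w = e²(κ+ρ)`, `D = |Γ|/2`, `m = 2p`. -/
theorem sum_range_filter_sum_pow_two_mul_eq_towerSLip {D n : ℕ} (hn : 1 ≤ n) (w : ℝ) {ν μ : ℕ → ℝ} (hν0 : ν 0 = 0) (hμ0 : μ 0 = 0)
    (p : ℕ) :
    ∑ δ ∈ (Fintype.piFinset fun _ : Fin n => range (D + 1)) with 2 * p + 2 * (n - 1) ≤ ∑ a, 2 * δ a,
        ∑ a, w ^ (2 * δ a) * ν (δ a) * ∏ b ∈ univ.erase a, w ^ (2 * δ b) * μ (δ b) = towerSLip D (w ^ 2) ν μ n p := by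
  simp only [pow_two_mul_eq_sq_pow]
  exact sum_range_filter_sum_mul_prod_erase_eq_towerSLip hn hν0 hμ0 p

end Summit.HubbardSuperconductivity.HubbardSuperconductivity.Theorems.EngineV8

end
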